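import Mathlib
import HarnessLib
import Summits.Parity.Statement
import Summits.Parity.GeneralizedHardyLittlewood.Theses.SiegelSpectrumSplit
import Summits.Parity.GeneralizedHardyLittlewood.Theses.BarrierZoneCarving
import Summits.Parity.BatemanHorn.Theses.OneSidedDegreeLadder
import Summits.Parity.GeneralizedHardyLittlewood.Theorems.ClusterGapCarvingTwinLowerGlue
import Summits.Parity.GeneralizedHardyLittlewood.Theorems.ScaleTauberianCarvingExactness
import Summits.Parity.GeneralizedHardyLittlewood.Theorems.GhostBoundaryCarvingTwoOfThreeNecessity
import Summits.Parity.GeneralizedHardyLittlewood.Theorems.ArtinGenericSplitNecessity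
import Summits.Parity.GeneralizedHardyLittlewood.Theorems.ShiftedPrimeFactorNecessity
import Literature.NumberTheory.Sieve.LinearEquationsInPrimesTwinSystem
import Literature.NumberTheory.Sieve.LinearEquationsInPrimesSubsystems
import Literature.NumberTheory.Sieve.GeneralizedHardyLittlewoodParityBoundary
import Literature.NumberTheory.Sieve.AletheiaZomleferFukshanskyGarcia2020Applications
import Literature.NumberTheory.Sieve.SingularSeriesProofs
import Literature.Barriers.Parity.PrimePairParity
import Literature.Barriers.Parity.SiegelZeroPrimePairs
import Summits.Parity.GeneralizedHardyLittlewood.Theorems.RootExistenceConservationDefs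

/-!
# Root existence conservation (1/4): propositional conservation, shapes against poverty, independence

Part of the CYCLE-2 ROOT CERTIFICATE «RootExistenceConservation» of the decomp-parity cell (lens-6 g9 NODE
HOME/STATUS.md l.468, REVISED v2 l.481; critic CLEARED l.472 = CRITIC-LEDGER row 87 against the spec (i)–(vi); writer
LANDING LIST L5 l.476).  The lens hand `HOME/decomp-parity-lens-6/g9/hand/RootExistenceConservation.lean`
(sha16 471e26ada0e68a15, 1250 lines, 99 theorems, 0 def, rc 0 · 0 sorry · standard axioms) is landed VERBATIM in four
files for the 400-line Theorems lint by the cell's prover-class seat census-1 g10: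
`RootExistenceConservationShapes` (§0–§2) → `RootExistenceConservationPatterns` (§3–§5a) →
`RootExistenceConservationTwins` (§5.1–§5.4) → `RootExistenceConservation` (§5.5–§5.9, barrier tie + door instances).
Vocabulary: `Theorems/RootExistenceConservationDefs.lean`.

§0 propositional conservation of refuting content (`complement_refutes{,₂,₃}`, `split_idle_in_world`,
`vacuous_and_refuting_exhaust`); §1 shapes of ONE counting sequence against poverty — vacuity (V), refutation (R),
transfer (T); §2 shape-level independence certificates (abstract ghost worlds).
-/

open scoped BigOperators
open Finset

namespace Summit.Parity.GeneralizedHardyLittlewood.ExistenceConservation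

/-! ## §0 Propositional conservation of refuting content -/

/-- **Conservation.** In a split `P → R → S` of a statement `S` refuting the world `W`, a `W`-vacuous piece
`P` leaves the whole refutation to its complement: `R → ¬W`. -/
theorem complement_refutes {W P R S : Prop} (hv : W → P) (hs : P → R → S) (hS : S → ¬W) : R → ¬W :=
  fun r w => hS (hs (hv w) r) w

/-- Two vacuous pieces: the third carries everything. -/
theorem complement_refutes₂ {W P₁ P₂ R S : Prop} (h₁ : W → P₁) (h₂ : W → P₂) (hs : P₁ → P₂ → R → S)
    (hS : S → ¬W) : R → ¬W :=
  fun r w => hS (hs (h₁ w) (h₂ w) r) w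

/-- Three vacuous pieces: the fourth carries everything. -/
theorem complement_refutes₃ {W P₁ P₂ P₃ R S : Prop} (h₁ : W → P₁) (h₂ : W → P₂) (h₃ : W → P₃)
    (hs : P₁ → P₂ → P₃ → R → S) (hS : S → ¬W) : R → ¬W :=
  fun r w => hS (hs (h₁ w) (h₂ w) (h₃ w) r) w

/-- Dually, a `W`-refuting piece makes the split idle inside `W`: nothing is asked of the complement there. -/
theorem split_idle_in_world {W P R S : Prop} (hP : P → ¬W) : W → P → R → S :=
  fun w p _ => absurd w (hP p)

/-- The two pieces of a content-dividing split are each consistent with `W` only if NEITHER is vacuous NOR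
refuting; in particular if one piece is vacuous the other is refuting (`complement_refutes`) and if one is
refuting the split asks nothing more (`split_idle_in_world`).  Recorded as the contrapositive used by the
critic: a piece that is both `W`-consistent-false somewhere and … — see §2 for the shape-level models. -/
theorem vacuous_and_refuting_exhaust {W P R S : Prop} (hs : P → R → S) (hS : S → ¬W) :
    (W → P) → (W → R) → ¬W :=
  fun hP hR w => hS (hs (hP w) (hR w)) w

/-! ## §1 Shapes of ONE counting sequence `c : ℕ → ℝ` (think `c N = Σ_{n≤N} Λ(n)Λ(n+2)`) against poverty -/

/-! ### Vacuity (V): shapes that HOLD in the poverty world -/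

/-- V1: one-sided upper statements are poverty-vacuous (main term `≥ 0`). -/
theorem upper_of_poor {c : ℕ → ℝ} {m : ℝ} (hm : 0 ≤ m) (h : Poor c) : Upper c m := by
  intro ε hε
  obtain ⟨N₀, h₀⟩ := h ε hε
  refine ⟨N₀, fun N hN => ?_⟩
  have h1 := (abs_le.mp (h₀ N hN)).2
  have h2 : 0 ≤ m * (N : ℝ) := mul_nonneg hm (Nat.cast_nonneg N)
  linarith

/-- V2: synchronisation of two POOR families is vacuous (both sides are `o(N)`). -/
theorem sync_of_poor {c₁ c₂ : ℕ → ℝ} {m₁ m₂ : ℝ} (h₁ : Poor c₁) (h₂ : Poor c₂) : Sync c₁ c₂ m₁ m₂ := by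
  intro ε hε
  set B : ℝ := |m₁| + |m₂| + 1 with hB
  have hBpos : 0 < B := by positivity
  obtain ⟨N₁, hN₁⟩ := h₁ (ε / B) (div_pos hε hBpos)
  obtain ⟨N₂, hN₂⟩ := h₂ (ε / B) (div_pos hε hBpos)
  refine ⟨max N₁ N₂, fun N hN => ?_⟩
  have a := hN₁ N (le_trans (le_max_left _ _) hN)
  have b := hN₂ N (le_trans (le_max_right _ _) hN)
  have hN0 : (0 : ℝ) ≤ N := Nat.cast_nonneg N
  calc |c₁ N * m₂ - c₂ N * m₁| ≤ |c₁ N * m₂| + |c₂ N * m₁| := abs_sub _ _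
    _ = |c₁ N| * |m₂| + |c₂ N| * |m₁| := by rw [abs_mul, abs_mul]
    _ ≤ ε / B * N * |m₂| + ε / B * N * |m₁| := by
        gcongr
    _ = ε / B * N * (|m₁| + |m₂|) := by ring
    _ ≤ ε / B * N * B := by
        apply mul_le_mul_of_nonneg_left _ (by positivity)
        linarith [abs_nonneg m₁]
    _ = ε * N := by field_simp

/-- V3: two-scale rigidity of the signed error is poverty-vacuous (both normalised counts are `≤ ε/2`; the main
term cancels in the difference). -/
theorem twoScale_of_poor {c : ℕ → ℝ} (m : ℝ) (h : Poor c) : TwoScale c m := by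
  intro ε hε
  obtain ⟨N₀, h₀⟩ := h (ε / 2) (by positivity)
  refine ⟨max N₀ 1, fun N hN n hNn _ => ?_⟩
  have hN₀ : N₀ ≤ N := le_trans (le_max_left _ _) hN
  have hN1 : 1 ≤ N := le_trans (le_max_right _ _) hN
  have hNpos : (0 : ℝ) < N := by exact_mod_cast hN1
  have hnpos : (0 : ℝ) < n := by exact_mod_cast (lt_of_lt_of_le hN1 hNn)
  have a := h₀ N hN₀
  have b := h₀ n (le_trans hN₀ hNn)
  have e1 : (c N - m * N) / N = c N / N - m := by field_simp
  have e2 : (c n - m * n) / n = c n / n - m := by field_simp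
  rw [e1, e2]
  have ha : |c N / N| ≤ ε / 2 := by
    rw [abs_div, abs_of_pos hNpos, div_le_iff₀ hNpos]; exact a
  have hb : |c n / n| ≤ ε / 2 := by
    rw [abs_div, abs_of_pos hnpos, div_le_iff₀ hnpos]; exact b
  calc |c N / N - m - (c n / n - m)| = |c N / N - c n / n| := by ring_nf
    _ ≤ |c N / N| + |c n / n| := abs_sub _ _
    _ ≤ ε := by linarith

/-- V4: «rare or exact» is poverty-vacuous (the rare branch). -/
theorem dichotomy_of_poor {c : ℕ → ℝ} (m : ℝ) (hc : ∀ N, 0 ≤ c N) (h : Poor c) : Dichotomy c m := by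
  intro ε hε
  obtain ⟨N₀, h₀⟩ := h (min ε 1) (lt_min hε one_pos)
  refine ⟨N₀, fun N hN => ?_⟩
  have hN0 : (0 : ℝ) ≤ N := Nat.cast_nonneg N
  have a := (abs_le.mp (h₀ N hN)).2
  have h1 : c N ≤ ε * N := le_trans a (mul_le_mul_of_nonneg_right (min_le_left _ _) hN0)
  have h1' : c N ≤ N := by
    have := mul_le_mul_of_nonneg_right (min_le_right ε 1) hN0
    linarith
  have h2 : |c N - m * N| ≤ N + |m * N| := by
    calc |c N - m * N| ≤ |c N| + |m * N| := abs_sub _ _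
      _ = c N + |m * N| := by rw [abs_of_nonneg (hc N)]
      _ ≤ N + |m * N| := by linarith
  calc c N * |c N - m * N| ≤ (ε * N) * (N + |m * N|) :=
        mul_le_mul h1 h2 (abs_nonneg _) (by positivity)
    _ = ε * N * (N + |m * N|) := by ring

/-- V4′: «rare or exact» is ALSO vacuous for an exact family (the exact branch) — so it holds in every ghost
world (each family poor or exact). -/
theorem dichotomy_of_exact {c : ℕ → ℝ} {m : ℝ} (h : Exact c m) : Dichotomy c m := by
  intro ε hε
  set B : ℝ := |m| + 1 with hB
  have hBpos : 0 < B := by positivity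
  obtain ⟨N₁, hN₁⟩ := h 1 one_pos
  obtain ⟨N₂, hN₂⟩ := h (ε / B) (div_pos hε hBpos)
  refine ⟨max N₁ N₂, fun N hN => ?_⟩
  have hN0 : (0 : ℝ) ≤ N := Nat.cast_nonneg N
  have a := hN₁ N (le_trans (le_max_left _ _) hN)
  have b := hN₂ N (le_trans (le_max_right _ _) hN)
  have hsize : c N ≤ B * N := by
    have a' := (abs_le.mp a).2
    have : m * (N : ℝ) ≤ |m| * N := mul_le_mul_of_nonneg_right (le_abs_self m) hN0
    rw [hB]; nlinarith
  calc c N * |c N - m * N| ≤ (B * N) * (ε / B * N) := mul_le_mul hsize b (abs_nonneg _) (by positivity)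
    _ = ε * N * N := by field_simp
    _ ≤ ε * N * (N + |m * N|) := by
        apply mul_le_mul_of_nonneg_left _ (by positivity)
        linarith [abs_nonneg (m * (N : ℝ))]

/-- R0: an eventual Chebyshev lower bound refutes poverty. -/
theorem not_poor_of_chebyshevEv {c : ℕ → ℝ} (h : ChebyshevEv c) : ¬ Poor c := by
  rintro hp
  obtain ⟨κ, hκ, N₀, h₀⟩ := h
  obtain ⟨N₁, h₁⟩ := hp (κ / 2) (by positivity)
  set N := max (max N₀ N₁) 1 with hNdef
  have a := h₀ N (le_trans (le_max_left _ _) (le_max_left _ _))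
  have b := (abs_le.mp (h₁ N (le_trans (le_max_right _ _) (le_max_left _ _)))).2
  have hN1 : (1 : ℝ) ≤ N := by exact_mod_cast (le_max_right _ _ : 1 ≤ N)
  nlinarith

/-- V5: a RELATIVE piece `(Chebyshev lower bound) → T` (`TwinResidualRel`, `TwinLowerDensityToGHL` shape) is
poverty-vacuous — its antecedent is refuted in `W`. -/
theorem relative_of_poor {c : ℕ → ℝ} {T : Prop} (hp : Poor c) : ChebyshevEv c → T :=
  fun h => absurd hp (not_poor_of_chebyshevEv h)

/-! ### Refutation (R): shapes that REFUTE the poverty world = carry the existence content -/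

/-- R1: a one-sided lower statement with positive main term refutes poverty. -/
theorem not_poor_of_lower {c : ℕ → ℝ} {m : ℝ} (hm : 0 < m) (h : Lower c m) : ¬ Poor c := by
  intro hp
  obtain ⟨N₁, h₁⟩ := h (m / 3) (by positivity)
  obtain ⟨N₂, h₂⟩ := hp (m / 3) (by positivity)
  set N := max (max N₁ N₂) 1 with hNdef
  have a := h₁ N (le_trans (le_max_left _ _) (le_max_left _ _))
  have b := (abs_le.mp (h₂ N (le_trans (le_max_right _ _) (le_max_left _ _)))).2
  have hN1 : (1 : ℝ) ≤ N := by exact_mod_cast (le_max_right _ _ : 1 ≤ N)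
  nlinarith

/-- R2: exactness with non-zero main term refutes poverty. -/
theorem not_poor_of_exact {c : ℕ → ℝ} {m : ℝ} (hm : m ≠ 0) (h : Exact c m) : ¬ Poor c := by
  intro hp
  have hm' : 0 < |m| := abs_pos.mpr hm
  obtain ⟨N₁, h₁⟩ := h (|m| / 3) (by positivity)
  obtain ⟨N₂, h₂⟩ := hp (|m| / 3) (by positivity)
  set N := max (max N₁ N₂) 1 with hNdef
  have a := h₁ N (le_trans (le_max_left _ _) (le_max_left _ _))
  have b := h₂ N (le_trans (le_max_right _ _) (le_max_left _ _))
  have hN1 : (1 : ℝ) ≤ N := by exact_mod_cast (le_max_right _ _ : 1 ≤ N)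
  have key : |m * (N : ℝ)| ≤ |m| / 3 * N + |m| / 3 * N := by
    calc |m * (N : ℝ)| = |c N - (c N - m * N)| := by ring_nf
      _ ≤ |c N| + |c N - m * N| := abs_sub _ _
      _ ≤ |m| / 3 * N + |m| / 3 * N := by linarith
  rw [abs_mul, abs_of_nonneg (by linarith : (0 : ℝ) ≤ N)] at key
  nlinarith

/-- R3: for a non-negative count, «not poor» IS «Chebyshev lower bound infinitely often» — the exact currency of
the existence content (what a poverty-refuting piece implies). -/
theorem not_poor_iff_chebyshevIO {c : ℕ → ℝ} (hc : ∀ N, 0 ≤ c N) : ¬ Poor c ↔ ChebyshevIO c := by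
  unfold Poor ChebyshevIO
  push Not
  constructor
  · rintro ⟨ε, hε, hio⟩
    refine ⟨ε, hε, fun N₀ => ?_⟩
    obtain ⟨N, hN, hlt⟩ := hio N₀
    exact ⟨N, hN, by rwa [abs_of_nonneg (hc N)] at hlt⟩
  · rintro ⟨κ, hκ, hio⟩
    refine ⟨κ, hκ, fun N₀ => ?_⟩
    obtain ⟨N, hN, hlt⟩ := hio N₀
    exact ⟨N, hN, by rwa [abs_of_nonneg (hc N)]⟩

/-- R4: log-window exactness with non-zero main term refutes poverty (in `W` the window mean of `c n/n − m` is
`≈ −m`, not `o(1)`). -/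
theorem not_poor_of_logExact {c : ℕ → ℝ} {m : ℝ} (hm : m ≠ 0) (h : LogExact c m) : ¬ Poor c := by
  intro hp
  have hm' : 0 < |m| := abs_pos.mpr hm
  obtain ⟨N₁, h₁⟩ := hp (|m| / 3) (by positivity)
  obtain ⟨N₂, h₂⟩ := h (|m| / 3) (by positivity)
  set N := max (max N₁ N₂) 2 with hNdef
  have hN₁ : N₁ ≤ N := le_trans (le_max_left _ _) (le_max_left _ _)
  have hN₂ : N₂ ≤ N := le_trans (le_max_right _ _) (le_max_left _ _)
  have hN2 : 2 ≤ N := le_max_right _ _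
  have hNM : N < N ^ 2 := by
    rw [pow_two]; exact lt_mul_of_one_lt_right (by omega) (by omega)
  have A := h₂ N hN₂ (N ^ 2) le_rfl
  set H : ℝ := ∑ n ∈ Ioc N (N ^ 2), (1 : ℝ) / n with hH
  have hHpos : 0 < H := by
    apply Finset.sum_pos
    · intro n hn
      have : (0 : ℝ) < n := by exact_mod_cast lt_trans (by omega : 0 < N) (Finset.mem_Ioc.mp hn).1
      positivity
    · exact ⟨N ^ 2, Finset.mem_Ioc.mpr ⟨hNM, le_rfl⟩⟩
  -- termwise: (c n / n - m)/n = (c n / n)/n - m * (1/n), and |(c n/n)/n| ≤ (|m|/3) * (1/n)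
  have hsplit : ∑ n ∈ Ioc N (N ^ 2), (c n / n - m) / n
      = ∑ n ∈ Ioc N (N ^ 2), c n / n / n - m * H := by
    rw [hH, Finset.mul_sum, ← Finset.sum_sub_distrib]
    refine Finset.sum_congr rfl fun n hn => ?_
    have hn : (0 : ℝ) < n := by exact_mod_cast lt_trans (by omega : 0 < N) (Finset.mem_Ioc.mp hn).1
    field_simp
  have hsmall : |∑ n ∈ Ioc N (N ^ 2), c n / n / n| ≤ |m| / 3 * H := by
    calc |∑ n ∈ Ioc N (N ^ 2), c n / n / n| ≤ ∑ n ∈ Ioc N (N ^ 2), |c n / n / n| :=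
          Finset.abs_sum_le_sum_abs _ _
      _ ≤ ∑ n ∈ Ioc N (N ^ 2), |m| / 3 * ((1 : ℝ) / n) := by
          refine Finset.sum_le_sum fun n hn => ?_
          have hNn : N < n := (Finset.mem_Ioc.mp hn).1
          have hn : (0 : ℝ) < n := by exact_mod_cast lt_trans (by omega : 0 < N) hNn
          have b := h₁ n (le_of_lt (lt_of_le_of_lt hN₁ hNn))
          rw [abs_div, abs_div, abs_of_pos hn, div_div, div_le_iff₀ (by positivity)]
          calc |c n| ≤ |m| / 3 * n := b
            _ = |m| / 3 * (1 / n) * (n * n) := by field_simp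
      _ = |m| / 3 * H := by rw [hH, Finset.mul_sum]
  rw [hsplit] at A
  have key : |m * H| ≤ |m| / 3 * H + |m| / 3 * H := by
    calc |m * H| = |(∑ n ∈ Ioc N (N ^ 2), c n / n / n) - (∑ n ∈ Ioc N (N ^ 2), c n / n / n - m * H)| := by
          ring_nf
      _ ≤ |∑ n ∈ Ioc N (N ^ 2), c n / n / n| + |∑ n ∈ Ioc N (N ^ 2), c n / n / n - m * H| := abs_sub _ _
      _ ≤ |m| / 3 * H + |m| / 3 * H := by linarith
  rw [abs_mul, abs_of_pos hHpos] at key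
  nlinarith

/-! ### Transfer (T): how content moves between two families -/

/-- T1: synchronisation transfers exactness from family 1 to family 2 (the `twinHL_of_pair_sync` mechanism,
abstractly). -/
theorem exact_of_sync {c₁ c₂ : ℕ → ℝ} {m₁ m₂ : ℝ} (hm₁ : 0 < m₁) (h₁ : Exact c₁ m₁)
    (hS : Sync c₁ c₂ m₁ m₂) : Exact c₂ m₂ := by
  intro ε hε
  set B : ℝ := |m₂| + 1 with hB
  have hBpos : 0 < B := by positivity
  obtain ⟨N₁, hN₁⟩ := h₁ (ε * m₁ / (2 * B)) (by positivity)
  obtain ⟨N₂, hN₂⟩ := hS (ε * m₁ / 2) (by positivity)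
  refine ⟨max N₁ N₂, fun N hN => ?_⟩
  have hN0 : (0 : ℝ) ≤ N := Nat.cast_nonneg N
  have a := hN₁ N (le_trans (le_max_left _ _) hN)
  have b := hN₂ N (le_trans (le_max_right _ _) hN)
  have key : |c₂ N - m₂ * N| * m₁ ≤ ε * N * m₁ := by
    have e : (c₂ N - m₂ * N) * m₁ = -(c₁ N * m₂ - c₂ N * m₁) + m₂ * (c₁ N - m₁ * N) := by ring
    calc |c₂ N - m₂ * N| * m₁ = |(c₂ N - m₂ * N) * m₁| := by rw [abs_mul, abs_of_pos hm₁]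
      _ = |-(c₁ N * m₂ - c₂ N * m₁) + m₂ * (c₁ N - m₁ * N)| := by rw [e]
      _ ≤ |-(c₁ N * m₂ - c₂ N * m₁)| + |m₂ * (c₁ N - m₁ * N)| := abs_add_le _ _
      _ = |c₁ N * m₂ - c₂ N * m₁| + |m₂| * |c₁ N - m₁ * N| := by rw [abs_neg, abs_mul]
      _ ≤ ε * m₁ / 2 * N + |m₂| * (ε * m₁ / (2 * B) * N) := by gcongr
      _ ≤ ε * m₁ / 2 * N + B * (ε * m₁ / (2 * B) * N) := by
          gcongr
          linarith [abs_nonneg m₂]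
      _ = ε * N * m₁ := by field_simp; ring
  exact le_of_mul_le_mul_right key hm₁

/-- T2: in the ASYMMETRIC world (family 1 exact, family 2 poor) synchronisation FAILS — so a transfer piece
from a family whose richness is a theorem is poverty-REFUTING outright. -/
theorem not_sync_of_exact_of_poor {c₁ c₂ : ℕ → ℝ} {m₁ m₂ : ℝ} (hm₁ : 0 < m₁) (hm₂ : m₂ ≠ 0)
    (h₁ : Exact c₁ m₁) (hp : Poor c₂) : ¬ Sync c₁ c₂ m₁ m₂ :=
  fun hS => not_poor_of_exact hm₂ (exact_of_sync hm₁ h₁ hS) hp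

/-! ## §2 Shape-level independence certificates (abstract ghost worlds) -/

/-- The zero family is poor. -/
theorem poor_zero : Poor (fun _ => 0) := fun ε hε => ⟨0, fun N _ => by simp; positivity⟩

/-- The family `c N = N` is exact with main term 1. -/
theorem exact_id : Exact (fun N => (N : ℝ)) 1 := fun ε hε => ⟨0, fun N _ => by simp; positivity⟩

/-- `Sync` is poverty-INDEPENDENT as a shape: it holds in the all-poor world and fails in the asymmetric one
(both worlds with family 2 poor). -/
theorem sync_independent :
    (∃ c₁ c₂ : ℕ → ℝ, Poor c₂ ∧ Sync c₁ c₂ 1 1) ∧ (∃ c₁ c₂ : ℕ → ℝ, Poor c₂ ∧ ¬ Sync c₁ c₂ 1 1) :=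
  ⟨⟨fun _ => 0, fun _ => 0, poor_zero, sync_of_poor poor_zero poor_zero⟩,
   ⟨fun N => (N : ℝ), fun _ => 0, poor_zero, not_sync_of_exact_of_poor one_pos one_ne_zero exact_id poor_zero⟩⟩

/-- «SOME family is exact» (`FarSomePair` / `SomePairHL` shape) is poverty-INDEPENDENT for a fixed family: with
family `false` poor, it fails in the all-poor world and holds when family `true` is exact. -/
theorem someExact_independent :
    (∃ c : Bool → ℕ → ℝ, Poor (c false) ∧ ¬ ∃ i, Exact (c i) 1) ∧
    (∃ c : Bool → ℕ → ℝ, Poor (c false) ∧ ∃ i, Exact (c i) 1) := by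
  refine ⟨⟨fun _ _ => 0, poor_zero, ?_⟩, ⟨fun i N => if i then (N : ℝ) else 0, poor_zero, ⟨true, ?_⟩⟩⟩
  · rintro ⟨i, hi⟩
    exact not_poor_of_exact one_ne_zero hi poor_zero
  · simpa using exact_id

/-- But «some family is exact» REFUTES the ALL-poor world (shape of `not_allPairsPoor_of_farSomePair`). -/
theorem someExact_refutes_allPoor {ι : Type*} {c : ι → ℕ → ℝ} {m : ι → ℝ} (hm : ∀ i, m i ≠ 0)
    (h : ∃ i, Exact (c i) (m i)) : ¬ ∀ i, Poor (c i) :=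
  fun hall => by obtain ⟨i, hi⟩ := h; exact not_poor_of_exact (hm i) hi (hall i)

end Summit.Parity.GeneralizedHardyLittlewood.ExistenceConservation
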